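import Summits.NavierStokesRegularity.NavierStokesRegularity.Theorems.PerpetualPumpAveragedTypeIBlowupSynthFieldTools

/-!
# Crux `PerpetualPump.AveragedTypeIBlowup` (stmt-NavierStokesRegularity-1835), line `Sketch`:
# stub `synthField`, modes — the drive `quadTerm(Y)` and the summable domination of the Duhamel terms

T. Tao, *Finite time blowup for an averaged three-dimensional Navier–Stokes equation*, J. Amer.
Math. Soc. **29** (2016), 601–674 = arXiv:1402.0290v3, §4 p. 22, (4.14), (4.8): the Duhamel terms
`D_{i,n}(t) = ∫₀ᵗ quadTerm(Y)_{i,n}(s) e^{(t-s)Δ}ψ_{i,n} ds` of the wavelet series of a chain solution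
`Y` on `[0,S)` vanishing below the scale `n₀` and with `(1+ε₀)^{20n}|Y_{i,n}| ≤ C` on `[0,S']`.

* `stub_synthFieldNoDrive` (registered sub-goal of the stub `synthField`): the drive
  `quadTerm(Y)_{i,n}` vanishes for `n ≤ n₀ - 2` (every monomial has a factor at a scale `≤ n+1`);
* `abs_quadTerm_le`: on `[0,S']`, `|quadTerm(Y)_{i,n}| ≤ (Σ|α|) C² (1+ε₀)^{(75/2)(1-n)}`;
* `exists_summable_bound`: after the band weight `W_{i,n} = (1_{R_{i,n}}(1+|ξ|²)⁵)(D)` of size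
  `(1+ρ_n²)⁵`, `ρ_n = (1+ε₀)ⁿ(1+ε₀/2)`, the norms `‖W_{i,n} D_{i,n}(t)‖`, `t ∈ [0,S']`, are dominated by
  a summable shifted geometric family of ratio `(1+ε₀)^{-55/2}` (`weight_decay_le`,
  `summable_shiftedGeometric`).

Nothing here closes the item (`--supports`); no statement of the route changes.

## References

* T. Tao, J. Amer. Math. Soc. 29 (2016), 601–674, arXiv:1402.0290v3, §4 p. 22 (4.14), (4.8).
  [`Tao2016AveragedNS`]
-/

noncomputable section

-- the summit namespace `…NavierStokesRegularity.NavierStokesRegularity…` is the tree convention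
set_option linter.dupNamespace false

open MeasureTheory Set Filter Topology
open scoped ENNReal
open scoped InnerProductSpace
open Literature.Analysis
open Literature.Analysis.FluidPDE Literature.Analysis.FluidPDE.Tao2016
open Literature.Analysis.FluidPDE.TaoCascade (quadTerm IsSymmetricCoeff IsCancellingCoeff shiftSet
  mem_shiftSet_iff)
open Summit.NavierStokesRegularity.NavierStokesRegularity.Theorems.PerpetualPumpEulerTypeIGlue
  (norm_heat_le continuous_heat_apply)

namespace Summit.NavierStokesRegularity.NavierStokesRegularity.Theorems.PerpetualPumpAveragedTypeIBlowup

variable {ε₀ : ℝ} {m : ℕ}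

/-! ### The drive `quadTerm(Y)_{i,n}`: continuity, vanishing below the datum scale, size -/

/-- The drive `s ↦ quadTerm(Y)_{i,n}(s)` (a finite sum of products of coefficients) is continuous
wherever all the `Y_{j,k}` are. [cite: Tao2016AveragedNS, §4 (4.8)] -/
theorem continuousOn_quadTerm (α : Fin m → Fin m → Fin m → ℤ × ℤ × ℤ → ℝ) {Y : Fin m → ℤ → ℝ → ℝ}
    {I : Set ℝ} (hY : ∀ i n, ContinuousOn (Y i n) I) (i : Fin m) (n : ℤ) :
    ContinuousOn (fun s => quadTerm ε₀ α Y i n s) I := by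
  unfold quadTerm
  refine continuousOn_finsetSum _ fun i₁ _ => continuousOn_finsetSum _ fun i₂ _ =>
    continuousOn_finsetSum _ fun μ _ => ?_
  exact continuousOn_const.mul ((hY _ _).mul (hY _ _))

/-- On the shift set `S = {(0,0,0),(1,0,0),(0,1,0),(0,0,1)}`: `0 ≤ μ₁ ≤ 1`, `0 ≤ μ₂`, `0 ≤ μ₃ ≤ 1`. [cite: Tao2016AveragedNS, §4 after (4.1)] -/
theorem shiftSet_bounds {μ : ℤ × ℤ × ℤ} (hμ : μ ∈ shiftSet) :
    0 ≤ μ.1 ∧ μ.1 ≤ 1 ∧ 0 ≤ μ.2.1 ∧ 0 ≤ μ.2.2 ∧ μ.2.2 ≤ 1 := by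
  rcases (mem_shiftSet_iff μ).1 hμ with rfl | rfl | rfl | rfl <;> simp

/-- **No drive below the datum scale** (registered sub-goal `stub_synthFieldNoDrive` of the stub
`synthField`): if `Y_{j,k} ≡ 0` for `k < n₀` then `quadTerm(Y)_{i,n} ≡ 0` for `n ≤ n₀ - 2` (every
monomial of `quadTerm_{i,n}` has a factor at a scale `≤ n + 1`). [cite: Tao2016AveragedNS, §4 (4.8)] -/
theorem stub_synthFieldNoDrive :
    ∀ {ε₀ : ℝ} {m : ℕ} (α : Fin m → Fin m → Fin m → ℤ × ℤ × ℤ → ℝ) {Y : Fin m → ℤ → ℝ → ℝ} {n₀ : ℤ},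
      (∀ i n t, n < n₀ → Y i n t = 0) → ∀ (i : Fin m) {n : ℤ}, n + 1 < n₀ → ∀ s : ℝ,
        quadTerm ε₀ α Y i n s = 0 := by
  intro ε₀ m α Y n₀ hlow i n hn s
  unfold quadTerm
  refine Finset.sum_eq_zero fun i₁ _ => Finset.sum_eq_zero fun i₂ _ =>
    Finset.sum_eq_zero fun μ hμ => ?_
  have h := shiftSet_bounds hμ
  exact mul_eq_zero_of_right _ (mul_eq_zero_of_left (hlow _ _ _ (by omega)) _)

/-- One monomial of the drive: if `|Y_{j,k}(s)| ≤ C (1+ε₀)^{-20k}` for all modes then, for `μ ∈ S`,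
`|a (1+ε₀)^{5(n-μ₃)/2} Y_{i₁,n-μ₃+μ₁}(s) Y_{i₂,n-μ₃+μ₂}(s)| ≤ |a| C² (1+ε₀)^{(75/2)(1-n)}`
(the two scales are `≥ n - 1`, and `μ₃ ≤ 1`). [cite: Tao2016AveragedNS, §4 (4.8)] -/
theorem abs_quadTerm_summand_le (hε₀ : 0 < ε₀) {C : ℝ} (hC0 : 0 ≤ C) {Y : Fin m → ℤ → ℝ → ℝ} {s : ℝ}
    (hY : ∀ j k, |Y j k s| ≤ C * (1 + ε₀) ^ (-(20 : ℝ) * k)) (a : ℝ) {μ : ℤ × ℤ × ℤ}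
    (hμ : μ ∈ shiftSet) (i₁ i₂ : Fin m) (n : ℤ) :
    |a * (1 + ε₀) ^ ((5 : ℝ) * (n - μ.2.2) / 2) *
        (Y i₁ (n - μ.2.2 + μ.1) s * Y i₂ (n - μ.2.2 + μ.2.1) s)| ≤
      |a| * C ^ 2 * (1 + ε₀) ^ ((75 : ℝ) / 2 * (1 - n)) := by
  obtain ⟨h1, -, h2, -, h3⟩ := shiftSet_bounds hμ
  have hL0 : 0 < 1 + ε₀ := by linarith
  have hL1 : 1 ≤ 1 + ε₀ := by linarith
  rw [abs_mul, abs_mul, abs_of_pos (Real.rpow_pos_of_pos hL0 _), abs_mul]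
  have hb := mul_le_mul (hY i₁ (n - μ.2.2 + μ.1)) (hY i₂ (n - μ.2.2 + μ.2.1)) (abs_nonneg _)
    (by positivity)
  calc |a| * (1 + ε₀) ^ ((5 : ℝ) * (n - μ.2.2) / 2) *
        (|Y i₁ (n - μ.2.2 + μ.1) s| * |Y i₂ (n - μ.2.2 + μ.2.1) s|)
      ≤ |a| * (1 + ε₀) ^ ((5 : ℝ) * (n - μ.2.2) / 2) *
          (C * (1 + ε₀) ^ (-(20 : ℝ) * (n - μ.2.2 + μ.1 : ℤ)) *
            (C * (1 + ε₀) ^ (-(20 : ℝ) * (n - μ.2.2 + μ.2.1 : ℤ)))) :=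
        mul_le_mul_of_nonneg_left hb (by positivity)
    _ = |a| * C ^ 2 * ((1 + ε₀) ^ ((5 : ℝ) * (n - μ.2.2) / 2) *
          (1 + ε₀) ^ (-(20 : ℝ) * (n - μ.2.2 + μ.1 : ℤ)) *
          (1 + ε₀) ^ (-(20 : ℝ) * (n - μ.2.2 + μ.2.1 : ℤ))) := by ring
    _ = |a| * C ^ 2 * (1 + ε₀) ^ ((5 : ℝ) * (n - μ.2.2) / 2 + -(20 : ℝ) * (n - μ.2.2 + μ.1 : ℤ) +
          -(20 : ℝ) * (n - μ.2.2 + μ.2.1 : ℤ)) := by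
        rw [Real.rpow_add hL0, Real.rpow_add hL0]
    _ ≤ |a| * C ^ 2 * (1 + ε₀) ^ ((75 : ℝ) / 2 * (1 - n)) := by
        refine mul_le_mul_of_nonneg_left (Real.rpow_le_rpow_of_exponent_le hL1 ?_) (by positivity)
        have f1 : (0 : ℝ) ≤ μ.1 := by exact_mod_cast h1
        have f2 : (0 : ℝ) ≤ μ.2.1 := by exact_mod_cast h2
        have f3 : (μ.2.2 : ℝ) ≤ 1 := by exact_mod_cast h3
        push_cast
        linarith

/-- **Size of the drive**: if `(1+ε₀)^{20k}|Y_{j,k}| ≤ C` on `[0,S']` for all modes, then on `[0,S']`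
`|quadTerm(Y)_{i,n}| ≤ (Σ_{i₁,i₂,μ} |α_{i₁,i₂,i,μ}|) C² (1+ε₀)^{(75/2)(1-n)}`. [cite: Tao2016AveragedNS, §4 (4.8)] -/
theorem abs_quadTerm_le (hε₀ : 0 < ε₀) (α : Fin m → Fin m → Fin m → ℤ × ℤ × ℤ → ℝ)
    {Y : Fin m → ℤ → ℝ → ℝ} {S' C : ℝ}
    (hC : ∀ (j : Fin m) (k : ℤ), ∀ s ∈ Icc 0 S', (1 + ε₀) ^ ((20 : ℝ) * k) * |Y j k s| ≤ C)
    (i : Fin m) (n : ℤ) {s : ℝ} (hs : s ∈ Icc 0 S') :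
    |quadTerm ε₀ α Y i n s| ≤
      (∑ i₁ : Fin m, ∑ i₂ : Fin m, ∑ μ ∈ shiftSet, |α i₁ i₂ i μ|) * C ^ 2 *
        (1 + ε₀) ^ ((75 : ℝ) / 2 * (1 - n)) := by
  have hL0 : 0 < 1 + ε₀ := by linarith
  have hC0 : 0 ≤ C :=
    le_trans (mul_nonneg (Real.rpow_pos_of_pos hL0 _).le (abs_nonneg _)) (hC i n s hs)
  have hY : ∀ j k, |Y j k s| ≤ C * (1 + ε₀) ^ (-(20 : ℝ) * k) := fun j k => by
    have h := hC j k s hs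
    have hpos : 0 < (1 + ε₀) ^ ((20 : ℝ) * k) := Real.rpow_pos_of_pos hL0 _
    rw [show -(20 : ℝ) * k = -((20 : ℝ) * k) by ring, Real.rpow_neg hL0.le, ← div_eq_mul_inv,
      le_div_iff₀ hpos, mul_comm]
    exact h
  unfold quadTerm
  refine (Finset.abs_sum_le_sum_abs _ _).trans ?_
  rw [Finset.sum_mul, Finset.sum_mul]
  refine Finset.sum_le_sum fun i₁ _ => (Finset.abs_sum_le_sum_abs _ _).trans ?_
  rw [Finset.sum_mul, Finset.sum_mul]
  refine Finset.sum_le_sum fun i₂ _ => (Finset.abs_sum_le_sum_abs _ _).trans ?_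
  rw [Finset.sum_mul, Finset.sum_mul]
  exact Finset.sum_le_sum fun μ hμ => abs_quadTerm_summand_le hε₀ hC0 hY _ hμ i₁ i₂ n

/-! ### A summable majorant across the modes -/

/-- **Geometric decay of the weighted drive across scales** (arithmetic): for `1 ≤ L`, `0 ≤ e ≤ L`
and `n + 1 = n₀ + k`,
`(1 + (Lⁿe)²)⁵ L^{(75/2)(1-n)} ≤ [(1 + (L^{n₀})²)⁵ L^{(75/2)(2-n₀)}] (L^{-55/2})ᵏ`
(band weight `(1+ρ_n²)⁵ ≲ L^{10k}` against drive decay `L^{-(75/2)k}`). [folklore] -/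
theorem weight_decay_le {L e : ℝ} (hL : 1 ≤ L) (he : 0 ≤ e) (heL : e ≤ L) {n₀ n : ℤ} {k : ℕ}
    (hk : n + 1 = n₀ + k) :
    (1 + (L ^ n * e) ^ 2) ^ 5 * L ^ ((75 : ℝ) / 2 * (1 - n)) ≤
      (1 + (L ^ n₀) ^ 2) ^ 5 * L ^ ((75 : ℝ) / 2 * (2 - n₀)) * (L ^ (-(55 : ℝ) / 2)) ^ k := by
  have hL0 : 0 < L := by linarith
  have h1 : L ^ n * e ≤ L ^ n₀ * L ^ k := by
    calc L ^ n * e ≤ L ^ n * L := mul_le_mul_of_nonneg_left heL (zpow_nonneg hL0.le _)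
      _ = L ^ (n + 1) := (zpow_add_one₀ hL0.ne' n).symm
      _ = L ^ n₀ * L ^ k := by rw [hk, zpow_add₀ hL0.ne', zpow_natCast]
  have h2 : 1 + (L ^ n * e) ^ 2 ≤ (1 + (L ^ n₀) ^ 2) * (L ^ k) ^ 2 := by
    have h3 : (L ^ n * e) ^ 2 ≤ (L ^ n₀ * L ^ k) ^ 2 :=
      pow_le_pow_left₀ (mul_nonneg (zpow_nonneg hL0.le _) he) h1 2
    have h4 : 1 ≤ (L ^ k) ^ 2 := one_le_pow₀ (one_le_pow₀ hL)
    rw [mul_pow] at h3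
    nlinarith [sq_nonneg (L ^ n₀)]
  have h5 : (1 + (L ^ n * e) ^ 2) ^ 5 ≤ (1 + (L ^ n₀) ^ 2) ^ 5 * L ^ (10 * k) := by
    calc (1 + (L ^ n * e) ^ 2) ^ 5 ≤ ((1 + (L ^ n₀) ^ 2) * (L ^ k) ^ 2) ^ 5 :=
          pow_le_pow_left₀ (by positivity) h2 5
      _ = (1 + (L ^ n₀) ^ 2) ^ 5 * L ^ (10 * k) := by
          rw [mul_pow]
          ring
  have h6 : L ^ ((75 : ℝ) / 2 * (1 - n)) =
      L ^ ((75 : ℝ) / 2 * (2 - n₀)) * L ^ (-(75 : ℝ) / 2 * k) := by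
    rw [← Real.rpow_add hL0]
    congr 1
    have h : ((n + 1 : ℤ) : ℝ) = ((n₀ + k : ℤ) : ℝ) := by rw [hk]
    push_cast at h
    linarith
  have h7 : L ^ (10 * k) * L ^ (-(75 : ℝ) / 2 * k) = (L ^ (-(55 : ℝ) / 2)) ^ k := by
    rw [← Real.rpow_natCast L (10 * k), ← Real.rpow_add hL0, ← Real.rpow_mul_natCast hL0.le]
    congr 1
    push_cast
    ring
  calc (1 + (L ^ n * e) ^ 2) ^ 5 * L ^ ((75 : ℝ) / 2 * (1 - n))
      ≤ ((1 + (L ^ n₀) ^ 2) ^ 5 * L ^ (10 * k)) *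
          (L ^ ((75 : ℝ) / 2 * (2 - n₀)) * L ^ (-(75 : ℝ) / 2 * k)) := by
        rw [← h6]
        exact mul_le_mul_of_nonneg_right h5 (Real.rpow_nonneg hL0.le _)
    _ = (1 + (L ^ n₀) ^ 2) ^ 5 * L ^ ((75 : ℝ) / 2 * (2 - n₀)) *
          (L ^ (10 * k) * L ^ (-(75 : ℝ) / 2 * k)) := by ring
    _ = (1 + (L ^ n₀) ^ 2) ^ 5 * L ^ ((75 : ℝ) / 2 * (2 - n₀)) * (L ^ (-(55 : ℝ) / 2)) ^ k := by
        rw [h7]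

/-- The shifted geometric family `p ↦ 1_{p.2 + 1 ≥ n₀} r^{p.2+1-n₀}` is summable over `Fin m × ℤ`
for `0 ≤ r < 1`. [folklore] -/
theorem summable_shiftedGeometric (n₀ : ℤ) {r : ℝ} (hr0 : 0 ≤ r) (hr1 : r < 1) :
    Summable fun p : Fin m × ℤ => if p.2 + 1 < n₀ then (0 : ℝ) else r ^ (p.2 + 1 - n₀).toNat := by
  have hnn : ∀ n : ℤ, 0 ≤ (if n + 1 < n₀ then (0 : ℝ) else r ^ (n + 1 - n₀).toNat) := fun n => by
    split_ifs <;> positivity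
  refine (summable_prod_of_nonneg fun p => hnn p.2).2 ⟨fun _ => ?_, (hasSum_fintype _).summable⟩
  have hg : Function.Injective fun k : ℕ => n₀ - 1 + k := fun a b h => by
    simpa using h
  refine (hg.summable_iff ?_).1 ?_
  · intro n hn
    have h' : n + 1 < n₀ := by
      by_contra h
      exact hn ⟨(n + 1 - n₀).toNat, by dsimp only; omega⟩
    exact if_pos h'
  · have h' : (fun n : ℤ => if n + 1 < n₀ then (0 : ℝ) else r ^ (n + 1 - n₀).toNat) ∘
        (fun k : ℕ => n₀ - 1 + k) = fun k => r ^ k := by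
      funext k
      simp only [Function.comp_apply]
      rw [if_neg (by omega)]
      congr 1
      omega
    exact h' ▸ summable_geometric_of_lt_one hr0 hr1

/-! ### The weighted Duhamel terms of the modes are dominated by a summable family -/

section Modes

variable (hε₀ : 0 < ε₀) (hε : 0 < 1 + ε₀) (𝒟 : CascadeWaveletData ε₀ m)
  (α : Fin m → Fin m → Fin m → ℤ × ℤ × ℤ → ℝ) {Y : Fin m → ℤ → ℝ → ℝ} {n₀ : ℤ} {S : ℝ}
  (hlow : ∀ i n t, n < n₀ → Y i n t = 0)
  (hdec : ∀ S' : ℝ, S' < S → ∃ C : ℝ, ∀ (i : Fin m) (n : ℤ), ∀ t ∈ Icc 0 S',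
    (1 + ε₀) ^ ((20 : ℝ) * n) * |Y i n t| ≤ C)

include hε₀ hlow hdec in
/-- **Summable domination of the weighted Duhamel terms on `[0,S']`, `S' < S`**: with `C` the
decay constant of `Y` on `[0,S']`, for every mode `p = (i,n)` and `t ∈ [0,S']`,
`‖W_{i,n} ∫₀ᵗ quadTerm(Y)_{i,n}(s) e^{(t-s)Δ}ψ_{i,n} ds‖ ≤ M_p` with `Σ_p M_p < ∞`: the term vanishes
for `n ≤ n₀ - 2`, and otherwise `‖W_{i,n}‖ ≤ (1+ρ_n²)⁵`, `‖∫₀ᵗ …‖ ≤ t sup|quadTerm| ‖ψ_{i,n}‖`,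
`‖ψ_{i,n}‖ = 1`, `sup|quadTerm| ≲ C²(1+ε₀)^{(75/2)(1-n)}`, and `weight_decay_le`. [cite: Tao2016AveragedNS, §4 p. 22 (4.14)] -/
theorem exists_summable_bound {S' : ℝ} (hS' : S' < S) :
    ∃ M : Fin m × ℤ → ℝ, Summable M ∧ ∀ (p : Fin m × ℤ), ∀ t ∈ Icc 0 S',
      ‖fourierMultiplier ((memLp_bandWeightFn (measurableSet_freqRegion 𝒟 p.1 p.2)
          (freqRegion_subset_closedBall hε 𝒟 p.1 p.2)).toLp _)
        (∫ s in (0 : ℝ)..t, ((quadTerm ε₀ α Y p.1 p.2 s : ℝ) : ℂ) •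
          heat (t - s) (cascadeWavelet ε₀ (𝒟.ψ p.1) p.2))‖ ≤ M p := by
  obtain ⟨C, hC⟩ := hdec S' hS'
  have hL1 : 1 ≤ 1 + ε₀ := by linarith
  have hr0 : 0 ≤ (1 + ε₀) ^ (-(55 : ℝ) / 2) := Real.rpow_nonneg hε.le _
  have hr1 : (1 + ε₀) ^ (-(55 : ℝ) / 2) < 1 :=
    Real.rpow_lt_one_of_one_lt_of_neg (by linarith) (by norm_num)
  set Aα : ℝ := ∑ i : Fin m, ∑ i₁ : Fin m, ∑ i₂ : Fin m, ∑ μ ∈ shiftSet, |α i₁ i₂ i μ| with hAα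
  set K : ℝ := (1 + ((1 + ε₀) ^ n₀) ^ 2) ^ 5 * (1 + ε₀) ^ ((75 : ℝ) / 2 * (2 - n₀)) *
    (Aα * C ^ 2 * max S' 0) with hK
  refine ⟨fun p => K * (if p.2 + 1 < n₀ then 0 else ((1 + ε₀) ^ (-(55 : ℝ) / 2)) ^ (p.2 + 1 - n₀).toNat),
    (summable_shiftedGeometric n₀ hr0 hr1).mul_left K, ?_⟩
  rintro ⟨i, n⟩ t ht
  dsimp only
  by_cases hn : n + 1 < n₀
  · -- below the datum scale the term vanishes
    have h0 : (fun s => ((quadTerm ε₀ α Y i n s : ℝ) : ℂ) • heat (t - s) (cascadeWavelet ε₀ (𝒟.ψ i) n)) =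
        fun _ => 0 := by
      funext s
      rw [stub_synthFieldNoDrive α hlow i hn s, Complex.ofReal_zero, zero_smul]
    rw [h0, intervalIntegral.integral_zero, fourierMultiplier_zero, norm_zero, if_pos hn, mul_zero]
  · rw [if_neg hn]
    have ht0 : 0 ≤ t := ht.1
    have hsub : Icc 0 t ⊆ Icc 0 S' := Icc_subset_Icc_right ht.2
    -- the drive on `[0,t]`
    have hq : ∀ s ∈ Icc 0 t, ‖((quadTerm ε₀ α Y i n s : ℝ) : ℂ)‖ ≤
        Aα * C ^ 2 * (1 + ε₀) ^ ((75 : ℝ) / 2 * (1 - n)) := by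
      intro s hs
      rw [Complex.norm_real, Real.norm_eq_abs]
      refine (abs_quadTerm_le hε₀ α hC i n (hsub hs)).trans ?_
      refine mul_le_mul_of_nonneg_right (mul_le_mul_of_nonneg_right ?_ (sq_nonneg _))
        (Real.rpow_nonneg hε.le _)
      exact Finset.single_le_sum (f := fun i => ∑ i₁ : Fin m, ∑ i₂ : Fin m, ∑ μ ∈ shiftSet, |α i₁ i₂ i μ|)
        (fun _ _ => by positivity) (Finset.mem_univ i)
    have hD := norm_intervalIntegral_smul_heat_le ht0 hq (cascadeWavelet ε₀ (𝒟.ψ i) n)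
    rw [𝒟.norm_cascadeWavelet hε i n, mul_one] at hD
    refine (norm_bandWeight_le (measurableSet_freqRegion 𝒟 i n) (freqRegion_subset_closedBall hε 𝒟 i n) _).trans ?_
    refine (mul_le_mul_of_nonneg_left hD (by positivity)).trans ?_
    -- arithmetic: `(1+ρ_n²)⁵ (Aα C² L^{(75/2)(1-n)} t) ≤ K r^k`
    obtain ⟨k, hk⟩ : ∃ k : ℕ, n + 1 = n₀ + k := ⟨(n + 1 - n₀).toNat, by omega⟩
    have hk' : (n + 1 - n₀).toNat = k := by omega
    rw [hk']
    have hw := weight_decay_le hL1 (by linarith : (0 : ℝ) ≤ 1 + ε₀ / 2) (by linarith : 1 + ε₀ / 2 ≤ 1 + ε₀) hk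
    have htS : t ≤ max S' 0 := ht.2.trans (le_max_left _ _)
    have hA0 : 0 ≤ Aα * C ^ 2 := by positivity
    calc (1 + ((1 + ε₀) ^ n * (1 + ε₀ / 2)) ^ 2) ^ 5 *
          (Aα * C ^ 2 * (1 + ε₀) ^ ((75 : ℝ) / 2 * (1 - n)) * t)
        = ((1 + ((1 + ε₀) ^ n * (1 + ε₀ / 2)) ^ 2) ^ 5 * (1 + ε₀) ^ ((75 : ℝ) / 2 * (1 - n))) *
            (Aα * C ^ 2 * t) := by ring
      _ ≤ ((1 + ((1 + ε₀) ^ n₀) ^ 2) ^ 5 * (1 + ε₀) ^ ((75 : ℝ) / 2 * (2 - n₀)) *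
            ((1 + ε₀) ^ (-(55 : ℝ) / 2)) ^ k) * (Aα * C ^ 2 * max S' 0) :=
          mul_le_mul hw (mul_le_mul_of_nonneg_left htS hA0) (mul_nonneg hA0 ht0) (by positivity)
      _ = K * ((1 + ε₀) ^ (-(55 : ℝ) / 2)) ^ k := by
          rw [hK]
          ring

end Modes

end Summit.NavierStokesRegularity.NavierStokesRegularity.Theorems.PerpetualPumpAveragedTypeIBlowup

end
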